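import Mathlib
import HarnessLib
import Summits.HubbardSuperconductivity.HubbardSuperconductivity.Theorems.KLProgrammeKLRegimeEngineScaleZeroV17F
import Summits.HubbardSuperconductivity.HubbardSuperconductivity.Theorems.KLProgrammeKLRegimeEngineV8DefsG7
import Summits.HubbardSuperconductivity.HubbardSuperconductivity.Theorems.KLProgrammeKLRegimeEngineScaleZeroE4PackageDoors

/-!
# Stub (a) `stub_engine_scale0` of the K3 ENGINE-FLOW child at the v7 package `klEngGeo7` (plan g17 (R33)), from the door-keyed
# (E4)₀ admissibility alone

Cell `gate-hubbard-kl`, seat hubbard-kl-k3c2-p1 g4 (row «scale-0 Gram step `stub_engine_scale0`»).  Composition of `…EngineScaleZeroV17F`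
(p529127: the flow-currency scale-`0` rung modulo (E4)₀, `G`-parametric) with `…EngineV8DefsG7` (`klEngGeo7 := klEngGeo6.raiseE4 klE4T6`,
`E4ScaleZeroAt6`, `klE4T6`): at the package the 20437 render carries after token #7 (`klEngGeo6 ↦ klEngGeo7`),

* `engineScaleZeroV17F2_klEng7_of_firstMoments` — the five-clause conclusion of stub (a) at `(klEngGeo7, klEngQ6 P R)` from (E4)₀ at `klEngGeo7`;
* `engineScaleZeroV17F2_klEng7_noE4` — the four (E4)-free conjuncts at `klEngGeo7`, unconditionally under the stub binders;
* **`engineScaleZeroV17F2_klEng7_of_e4ScaleZeroAt6`** — the five-clause conclusion from ANY witness `E4ScaleZeroAt6 E` (`0 ≤ E`);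
* `stub_engine_scale0_klEng7_of_exists_e4ScaleZeroAt6` — LITERALLY the registered text of stub (a) at `klEngGeo7` (binder for binder), from
  `∃ E, 0 ≤ E ∧ E4ScaleZeroAt6 E`;
* **`exists_e4ScaleZeroAt6`**, **`e4ScaleZeroAt6_klE4T6_holds : E4ScaleZeroAt6 klE4T6`** — the WITNESS, a binder reshuffle of p4 g9's door-closed (E4)₀
  `exists_engineFirstMoments_zero_klEng6` (`…ScaleZeroE4PackageDoors`, p529428; `Q := klEngQ6 P R`, `(klEngQ5 P R).cE4 ≤ (klEngQ6 P R).cE4` by `le_rfl`);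
* **`stub_engine_scale0_klEng7`** — THE STUB: the registered text of stub (a) `stub_engine_scale0` of the engine-flow skeleton at the v7 package,
  UNCONDITIONALLY (all five conjuncts: (E1-v4)₀ k3c2-p1 g2, (E2-F2)₀/(E2′-F UV)₀ p3 g6, (E4)₀ p4 g9 + k3c2-p1 g3 + k3c4-p2, (E5-F)₀ p4 g7/p3 g6).

Bookkeeping only; nothing about the model is asserted beyond the cited upstream theorems; nothing asserts superconductivity.
-/

noncomputable section

namespace Summit.HubbardSuperconductivity.HubbardSuperconductivity.Theorems.EngineV8

set_option linter.dupNamespace false -- summit = problem name (single-conjunct summit), D-0017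

open Real Finset Literature.MathematicalPhysics.QuantumLattice Literature.Probability.LatticeModels
open Summit.HubbardSuperconductivity.HubbardSuperconductivity.Theorems.KLRegimeSplit
open Summit.HubbardSuperconductivity.HubbardSuperconductivity.Theorems.KLProgrammeLegKernels

/-- **Stub (a) at `klEngGeo7` modulo (E4)₀**: under exactly the stub's binders, `EngineFirstMoments L M klEngGeo7 P (klEngQ6 P R) β U μ K₀ 0`
implies the five-clause conclusion at `(klEngGeo7, klEngQ6 P R)` (`klIsoT ^ 4 ≤ klEngGeo7.CF` by `klIsoT_pow_four_le_klEngGeo7_CF`). -/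
theorem engineScaleZeroV17F2_klEng7_of_firstMoments (P : SplitConsts) (R : RenConsts) (c : ℝ) (hP : P.WF) (hR : R.WF2) (hc : 0 < c)
    (hc₆ : c ≤ klEngC₃6 P R) (μ : ℝ) (hμ : μ ∈ klWindowC) (U : ℝ) (hU : 0 < U) (hU₀ : U ≤ klEngU₀6 P R c) (β : ℝ)
    (hβ : klBetaMin ≤ β) (hβc : β ≤ Real.exp (c / U ^ 2)) (L M : ℕ) [NeZero L] [NeZero M] (hL : klEngL₃ β U ≤ L)
    (hM : klEngM₃ β U L ≤ M) (hK : FrameOK R U (nScales β) μ (klFlowFrameU L M β U μ 0))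
    (hE4 : EngineFirstMoments L M klEngGeo7 P (klEngQ6 P R) β U μ (klFlowFrameU L M β U μ 0) 0) :
    KernelNormsV4 L M P (klEngQ6 P R) β U μ (klFlowFrameU L M β U μ 0) 0 ∧
      PairLadderStepAtV17F2 L M klEngGeo7 P (klEngQ6 P R) β U μ 0 ∧
        QuarticValueUVAtV17F L M klEngGeo7 P (klEngQ6 P R) β U μ 0 ∧
          EngineFirstMoments L M klEngGeo7 P (klEngQ6 P R) β U μ (klFlowFrameU L M β U μ 0) 0 ∧
            IsoTupleL1AtV17F L M klEngGeo7 P β U μ 0 :=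
  engineScaleZeroV17F2_of_firstMoments klEngGeo7 klEngGeo7_wf klIsoT_pow_four_le_klEngGeo7_CF P R c hP hR hc hc₆ μ hμ U hU hU₀ β hβ
    hβc L M hL hM hK hE4

/-- **The four (E4)-free conjuncts of stub (a) at `klEngGeo7`, unconditionally** under the stub binders. -/
theorem engineScaleZeroV17F2_klEng7_noE4 (P : SplitConsts) (R : RenConsts) (c : ℝ) (hP : P.WF) (hR : R.WF2) (hc : 0 < c)
    (hc₆ : c ≤ klEngC₃6 P R) (μ : ℝ) (hμ : μ ∈ klWindowC) (U : ℝ) (hU : 0 < U) (hU₀ : U ≤ klEngU₀6 P R c) (β : ℝ)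
    (hβ : klBetaMin ≤ β) (hβc : β ≤ Real.exp (c / U ^ 2)) (L M : ℕ) [NeZero L] [NeZero M] (hL : klEngL₃ β U ≤ L)
    (hM : klEngM₃ β U L ≤ M) (hK : FrameOK R U (nScales β) μ (klFlowFrameU L M β U μ 0)) :
    KernelNormsV4 L M P (klEngQ6 P R) β U μ (klFlowFrameU L M β U μ 0) 0 ∧
      PairLadderStepAtV17F2 L M klEngGeo7 P (klEngQ6 P R) β U μ 0 ∧
        QuarticValueUVAtV17F L M klEngGeo7 P (klEngQ6 P R) β U μ 0 ∧ IsoTupleL1AtV17F L M klEngGeo7 P β U μ 0 :=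
  engineScaleZeroV17F2_noE4 klEngGeo7 klEngGeo7_wf klIsoT_pow_four_le_klEngGeo7_CF P R c hP hR hc hc₆ μ hμ U hU hU₀ β hβ hβc L M hL hM
    hK

/-- **Stub (a) at `klEngGeo7` from ANY door-keyed (E4)₀ witness**: `E4ScaleZeroAt6 E` with `0 ≤ E` and the stub binders give the five-clause
conclusion at `(klEngGeo7, klEngQ6 P R)`. -/
theorem engineScaleZeroV17F2_klEng7_of_e4ScaleZeroAt6 {E : ℝ} (hE0 : 0 ≤ E) (hE : E4ScaleZeroAt6 E) (P : SplitConsts) (R : RenConsts)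
    (c : ℝ) (hP : P.WF) (hR : R.WF2) (hc : 0 < c) (hc₆ : c ≤ klEngC₃6 P R) (μ : ℝ) (hμ : μ ∈ klWindowC) (U : ℝ) (hU : 0 < U)
    (hU₀ : U ≤ klEngU₀6 P R c) (β : ℝ) (hβ : klBetaMin ≤ β) (hβc : β ≤ Real.exp (c / U ^ 2)) (L M : ℕ) [NeZero L] [NeZero M]
    (hL : klEngL₃ β U ≤ L) (hM : klEngM₃ β U L ≤ M) (hK : FrameOK R U (nScales β) μ (klFlowFrameU L M β U μ 0)) :
    KernelNormsV4 L M P (klEngQ6 P R) β U μ (klFlowFrameU L M β U μ 0) 0 ∧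
      PairLadderStepAtV17F2 L M klEngGeo7 P (klEngQ6 P R) β U μ 0 ∧
        QuarticValueUVAtV17F L M klEngGeo7 P (klEngQ6 P R) β U μ 0 ∧
          EngineFirstMoments L M klEngGeo7 P (klEngQ6 P R) β U μ (klFlowFrameU L M β U μ 0) 0 ∧
            IsoTupleL1AtV17F L M klEngGeo7 P β U μ 0 :=
  engineScaleZeroV17F2_klEng7_of_firstMoments P R c hP hR hc hc₆ μ hμ U hU hU₀ β hβ hβc L M hL hM hK
    (engineFirstMoments_zero_klEngGeo7_of_e4ScaleZeroAt6 hE0 hE P R c hP hR hc hc₆ μ hμ U hU hU₀ β hβ hβc (klFlowFrameU L M β U μ 0)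
      hK L M hL hM)

/-- **LITERALLY the registered text of stub (a) `stub_engine_scale0` of the engine-flow skeleton on stmt-HubbardSuperconductivity-20437 at the
v7 package** (`klEngGeo7`, `klEngQ6 P R`, doors `klEngC₃6`/`klEngU₀6`, `klEngL₃`/`klEngM₃`, frame `K₀ = klFlowFrameU L M β U μ 0`), from the
existence of a nonnegative door-keyed admissible (E4)₀ constant.  The (E4)₀ packager's export `∃ E, 0 ≤ E ∧ E4ScaleZeroAt6 E` closes the stub
through this theorem by name. -/
theorem stub_engine_scale0_klEng7_of_exists_e4ScaleZeroAt6 (h : ∃ E : ℝ, 0 ≤ E ∧ E4ScaleZeroAt6 E) :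
    ∀ (P : SplitConsts) (R : RenConsts) (c : ℝ), P.WF → R.WF2 → 0 < c → c ≤ klEngC₃6 P R →
      ∀ μ ∈ klWindowC, ∀ U : ℝ, 0 < U → U ≤ klEngU₀6 P R c → ∀ β : ℝ, klBetaMin ≤ β → β ≤ Real.exp (c / U ^ 2) →
        ∀ (L M : ℕ) [NeZero L] [NeZero M], klEngL₃ β U ≤ L → klEngM₃ β U L ≤ M →
          FrameOK R U (nScales β) μ (klFlowFrameU L M β U μ 0) →
            KernelNormsV4 L M P (klEngQ6 P R) β U μ (klFlowFrameU L M β U μ 0) 0 ∧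
              PairLadderStepAtV17F2 L M klEngGeo7 P (klEngQ6 P R) β U μ 0 ∧
                QuarticValueUVAtV17F L M klEngGeo7 P (klEngQ6 P R) β U μ 0 ∧
                  EngineFirstMoments L M klEngGeo7 P (klEngQ6 P R) β U μ (klFlowFrameU L M β U μ 0) 0 ∧
                    IsoTupleL1AtV17F L M klEngGeo7 P β U μ 0 := by
  obtain ⟨E, hE0, hE⟩ := h
  intro P R c hP hR hc hc₆ μ hμ U hU hU₀ β hβ hβc L M _ _ hL hM hK
  exact engineScaleZeroV17F2_klEng7_of_e4ScaleZeroAt6 hE0 hE P R c hP hR hc hc₆ μ hμ U hU hU₀ β hβ hβc L M hL hM hK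

/-! ## The witness and the unconditional stub -/

/-- **`∃ E ≥ 0, E4ScaleZeroAt6 E`** — the door-keyed (E4)₀ admissibility HAS a witness: p4 g9's `exists_engineFirstMoments_zero_klEng6`
(`…ScaleZeroE4PackageDoors`) read at `Q := klEngQ6 P R` (`(klEngQ5 P R).cE4 ≤ (klEngQ6 P R).cE4` is `le_rfl`: `raiseCE` does not touch `cE4`). -/
theorem exists_e4ScaleZeroAt6 : ∃ E : ℝ, 0 ≤ E ∧ E4ScaleZeroAt6 E := by
  obtain ⟨E, hE0, h⟩ := exists_engineFirstMoments_zero_klEng6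
  exact ⟨E, hE0, fun G _ hGE P R c hP hR hc hc₆ μ hμ U hU hU₀ β hβ hβc K hK L M _ _ hL hM =>
    h G P R (klEngQ6 P R) hGE le_rfl c hP hR hc hc₆ μ hμ U hU hU₀ β hβ hβc K hK L M hL hM⟩

/-- **`klE4T6` IS admissible** (so it is the honest `Classical.choose` branch, never the `0` branch). -/
theorem e4ScaleZeroAt6_klE4T6_holds : E4ScaleZeroAt6 klE4T6 := by
  obtain ⟨E, hE0, hE⟩ := exists_e4ScaleZeroAt6
  exact e4ScaleZeroAt6_klE4T6 hE0 hE

/-- **(E4)₀ at `klEngGeo7`, unconditionally under the binders of stub (a)** (any admissible frame `K`; in the flow child `K = K₀`). -/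
theorem engineFirstMoments_zero_klEngGeo7 (P : SplitConsts) (R : RenConsts) (c : ℝ) (hP : P.WF) (hR : R.WF2) (hc : 0 < c)
    (hc₆ : c ≤ klEngC₃6 P R) (μ : ℝ) (hμ : μ ∈ klWindowC) (U : ℝ) (hU : 0 < U) (hU₀ : U ≤ klEngU₀6 P R c) (β : ℝ)
    (hβ : klBetaMin ≤ β) (hβc : β ≤ Real.exp (c / U ^ 2)) (K : TrigPolyC4v) (hK : FrameOK R U (nScales β) μ K) (L M : ℕ) [NeZero L]
    [NeZero M] (hL : klEngL₃ β U ≤ L) (hM : klEngM₃ β U L ≤ M) : EngineFirstMoments L M klEngGeo7 P (klEngQ6 P R) β U μ K 0 :=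
  engineFirstMoments_zero_of_e4ScaleZeroAt6 klE4T6_nonneg e4ScaleZeroAt6_klE4T6_holds klEngGeo7 klEngGeo7_wf klE4T6_le_klEngGeo7_cE4 P R
    c hP hR hc hc₆ μ hμ U hU hU₀ β hβ hβc K hK L M hL hM

/-- **STUB (a) `stub_engine_scale0` OF THE ENGINE-FLOW SKELETON AT THE v7 PACKAGE — PROVED.**  Literally the registered text (template twin B
`3d02100cd7d5991d` with the rev-22 tokens `…V17F2` and token #7 `klEngGeo6 ↦ klEngGeo7`): for every `P R c` with `P.WF`, `R.WF2`, `0 < c ≤ klEngC₃6 P R`,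
`μ ∈ klWindowC`, `0 < U ≤ klEngU₀6 P R c`, `klBetaMin ≤ β ≤ e^{c/U²}`, volumes above `klEngL₃ / klEngM₃`, and the bare flow frame
`K₀ = klFlowFrameU L M β U μ 0` admissible: (E1-v4)₀ ∧ (E2-F2)₀ ∧ (E2′-F UV)₀ ∧ (E4)₀ ∧ (E5-F)₀ at `(klEngGeo7, klEngQ6 P R)`. -/
theorem stub_engine_scale0_klEng7 :
    ∀ (P : SplitConsts) (R : RenConsts) (c : ℝ), P.WF → R.WF2 → 0 < c → c ≤ klEngC₃6 P R →
      ∀ μ ∈ klWindowC, ∀ U : ℝ, 0 < U → U ≤ klEngU₀6 P R c → ∀ β : ℝ, klBetaMin ≤ β → β ≤ Real.exp (c / U ^ 2) →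
        ∀ (L M : ℕ) [NeZero L] [NeZero M], klEngL₃ β U ≤ L → klEngM₃ β U L ≤ M →
          FrameOK R U (nScales β) μ (klFlowFrameU L M β U μ 0) →
            KernelNormsV4 L M P (klEngQ6 P R) β U μ (klFlowFrameU L M β U μ 0) 0 ∧
              PairLadderStepAtV17F2 L M klEngGeo7 P (klEngQ6 P R) β U μ 0 ∧
                QuarticValueUVAtV17F L M klEngGeo7 P (klEngQ6 P R) β U μ 0 ∧
                  EngineFirstMoments L M klEngGeo7 P (klEngQ6 P R) β U μ (klFlowFrameU L M β U μ 0) 0 ∧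
                    IsoTupleL1AtV17F L M klEngGeo7 P β U μ 0 :=
  stub_engine_scale0_klEng7_of_exists_e4ScaleZeroAt6 exists_e4ScaleZeroAt6

end Summit.HubbardSuperconductivity.HubbardSuperconductivity.Theorems.EngineV8

end
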